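import Literature.Barriers.CriticalPhenomena.LongRangeTrivialityOnZ3MMS

/-!
# Discharge of `panis_mms_two_point_monotone` (Panis 2023, Corollary 3.3, (MMS2)):
# `⟨σ₀σ_y⟩_β ≤ ⟨σ₀σ_x⟩_β` whenever `d|x|_∞ ≤ |y|_∞`, for `J_{x,y} = C₀|x-y|₁^{-d-α}`

Sibling of `LongRangeTrivialityOnZ3MMS.lean` (the Messager–Miracle-Solé inequality for ferromagnetic
pair interactions, finite volume and infinite-volume state) and second half of the discharge of the
named fact `panis_mms_two_point_monotone` of `LongRangeTrivialityOnZ3TwoPoint.lean`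
(`panis_mms_two_point_monotone_holds`, at the end).

1. **`ℓ¹` geometry of the reflections.** The reflections `axisRefl i k` (through `{yᵢ = k/2}`) and
   `diagRefl i j c` (through `{yᵢ - yⱼ = c}`) of `MessagerMiracleSole.lean` and the signed coordinate
   permutations preserve `|x - y|₁`, and reflecting one of two points on the non-positive side
   `{2yᵢ ≤ k}`, resp. `{yᵢ - yⱼ ≤ c}`, does not decrease their `ℓ¹` distance
   (`l1Norm_sub_le_l1Norm_sub_axisRefl`, `l1Norm_sub_le_l1Norm_sub_diagRefl`). Hence every coupling
   `J ≥ 0` that is a nonincreasing function of `|x-y|₁` off the diagonal (hypotheses `hJl1`,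
   `hJanti`; e.g. `algebraicCoupling d C₀ α = C₀|x-y|₁^{-d-α}`, `algebraicCoupling_eq_of_l1Norm_eq`,
   `algebraicCoupling_anti`) is reflection invariant and reflection dominated, and
   `state_pair_reflect_le` gives the two elementary monotonicity steps of the two-point function
   `S(x) = ⟨σ₀σ_x⟩_{J,0,β}` (`β ≥ 0`): `S(x + eᵢ) ≤ S(x)` for `xᵢ ≥ 0` (Hegerfeldt 1977, Thm. 3.1,
   eq. (3.8); Panis 2023, Corollary 3.3 (i)) and `S(x + eᵢ - eⱼ) ≤ S(x)` for `xⱼ ≤ xᵢ` (Hegerfeldt 1977,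
   Thm. 3.2, eq. (3.10)), together with the invariance of `S` under signed coordinate permutations.
2. **The walk (MMS1 ⟹ MMS2).** For ANY function `S` on `ℤ^d` with these three properties,
   `S(y) ≤ S(|y|_∞ e₁)` and `S(d|x|_∞ e₁) ≤ S(x)` (reflect into the positive orthant, zero / collapse
   coordinates, walk out along the axis; the combinatorics of Duminil-Copin 2019, §4.3, Exercise 37 (4),
   as in `MessagerMiracleSoleFree.lean` for the nearest-neighbour free state), whence
   `S(y) ≤ S(x)` for `d|x|_∞ ≤ |y|_∞` (`walk_mms2`) — Panis's chain
   `S(x) ≥ S((|x|₁,0_⊥)) ≥ S((|y|_∞,0_⊥)) ≥ S(y)` of Corollary 3.3.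
3. **Assembly** for `J_{x,y} = C₀|x-y|₁^{-d-α}`, `C₀, α > 0`, `β > 0`, `d ≥ 1`, with `‖·‖ = |·|_∞`
   (`Site.norm_eq_supNorm`).

## References

* R. Panis, arXiv:2309.05797 (2023) = Ann. Probab. 54 (2026), Proposition 3.2, Corollary 3.3
  (i), (ii) (MMS1), (MMS2) [Panis2023Triviality] (held; read pp. 11, 13–14: `|·|` is the sup norm).
* G. C. Hegerfeldt, Comm. Math. Phys. 57 (1977) 259–266, Thm. 3.1 (3.8), Thm. 3.2 (3.10)
  [Hegerfeldt1977]; A. Messager, S. Miracle-Solé, J. Stat. Phys. 17 (1977) 245–262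
  [MessagerMiracleSoleJSP1977].
* H. Duminil-Copin, *Lectures on the Ising and Potts models on the hypercubic lattice* (2019), §4.3,
  Exercise 37 (4) and eq. (4.10) [DuminilCopin2019].
-/

noncomputable section

namespace Literature.Barriers.CriticalPhenomena

open Literature.Probability.LatticeModels Literature.Probability.Percolation Filter Topology Finset
open scoped symmDiff

namespace LongRangeIsing

variable {d : ℕ}

/-! ### `ℓ¹` geometry of the reflections and of the signed permutations -/

section L1Geometry

/-- `|z|₁ = 0 ↔ z = 0`. [folklore] -/
theorem l1Norm_eq_zero_iff {z : Site d} : l1Norm z = 0 ↔ z = 0 := by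
  rw [l1Norm, Finset.sum_eq_zero_iff]
  constructor
  · intro h
    funext i
    exact Int.natAbs_eq_zero.1 (h i (mem_univ i))
  · rintro rfl i _
    simp

/-- Splitting a sum over the coordinates at two distinct indices. [folklore] -/
theorem sum_eq_add_add_sum_erase_erase {i j : Fin d} (hij : i ≠ j) (f : Fin d → ℕ) :
    ∑ l, f l = f i + f j + ∑ l ∈ (univ.erase i).erase j, f l := by
  rw [← Finset.add_sum_erase _ f (mem_univ i),
    ← Finset.add_sum_erase _ f (Finset.mem_erase.2 ⟨hij.symm, mem_univ j⟩), add_assoc]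

/-- The reflection through `{yᵢ = k/2}` is an `ℓ¹` isometry. [folklore] -/
theorem l1Norm_axisRefl_sub (i : Fin d) (k : ℤ) (x y : Site d) :
    l1Norm (axisRefl i k x - axisRefl i k y) = l1Norm (x - y) := by
  unfold l1Norm
  refine Finset.sum_congr rfl fun j _ => ?_
  simp only [Pi.sub_apply, axisRefl_apply]
  split_ifs with h
  · subst h
    omega
  · rfl

/-- Reflecting one of two points of the closed non-positive side `{2yᵢ ≤ k}` through `{yᵢ = k/2}`
does not decrease their `ℓ¹` distance. [folklore] -/
theorem l1Norm_sub_le_l1Norm_sub_axisRefl (i : Fin d) {k : ℤ} {x y : Site d} (hx : 2 * x i ≤ k)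
    (hy : 2 * y i ≤ k) : l1Norm (x - y) ≤ l1Norm (x - axisRefl i k y) := by
  unfold l1Norm
  refine Finset.sum_le_sum fun j _ => ?_
  simp only [Pi.sub_apply, axisRefl_apply]
  split_ifs with h
  · subst h
    omega
  · exact le_rfl

/-- The reflection through `{yᵢ - yⱼ = c}` is an `ℓ¹` isometry. [folklore] -/
theorem l1Norm_diagRefl_sub {i j : Fin d} (hij : i ≠ j) (c : ℤ) (x y : Site d) :
    l1Norm (diagRefl i j c x - diagRefl i j c y) = l1Norm (x - y) := by
  unfold l1Norm
  rw [sum_eq_add_add_sum_erase_erase hij, sum_eq_add_add_sum_erase_erase hij (fun l => ((x - y) l).natAbs)]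
  have hi : ((diagRefl i j c x - diagRefl i j c y) i).natAbs = ((x - y) j).natAbs := by
    simp only [Pi.sub_apply, diagRefl_apply hij, if_true]
    omega
  have hj : ((diagRefl i j c x - diagRefl i j c y) j).natAbs = ((x - y) i).natAbs := by
    simp only [Pi.sub_apply, diagRefl_apply hij, if_true, if_neg hij.symm]
    omega
  have hrest : ∑ l ∈ (univ.erase i).erase j, ((diagRefl i j c x - diagRefl i j c y) l).natAbs =
      ∑ l ∈ (univ.erase i).erase j, ((x - y) l).natAbs := by
    refine Finset.sum_congr rfl fun l hl => ?_
    have hlj : l ≠ j := Finset.ne_of_mem_erase hl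
    have hli : l ≠ i := Finset.ne_of_mem_erase (Finset.mem_of_mem_erase hl)
    simp only [Pi.sub_apply, diagRefl_apply hij, if_neg hli, if_neg hlj]
  rw [hi, hj, hrest]
  ring

/-- Reflecting one of two points of the closed non-positive side `{yᵢ - yⱼ ≤ c}` through
`{yᵢ - yⱼ = c}` does not decrease their `ℓ¹` distance (in the coordinates `u = yᵢ - yⱼ - c`,
`v = yᵢ + yⱼ` the reflection is `u ↦ -u` and `|Δyᵢ| + |Δyⱼ| = max(|Δu|, |Δv|)`). [folklore] -/
theorem l1Norm_sub_le_l1Norm_sub_diagRefl {i j : Fin d} (hij : i ≠ j) {c : ℤ} {x y : Site d}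
    (hx : x i - x j ≤ c) (hy : y i - y j ≤ c) : l1Norm (x - y) ≤ l1Norm (x - diagRefl i j c y) := by
  unfold l1Norm
  rw [sum_eq_add_add_sum_erase_erase hij,
    sum_eq_add_add_sum_erase_erase hij (fun l => ((x - diagRefl i j c y) l).natAbs)]
  have hrest : ∑ l ∈ (univ.erase i).erase j, ((x - diagRefl i j c y) l).natAbs =
      ∑ l ∈ (univ.erase i).erase j, ((x - y) l).natAbs := by
    refine Finset.sum_congr rfl fun l hl => ?_
    have hlj : l ≠ j := Finset.ne_of_mem_erase hl
    have hli : l ≠ i := Finset.ne_of_mem_erase (Finset.mem_of_mem_erase hl)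
    simp only [Pi.sub_apply, diagRefl_apply hij, if_neg hli, if_neg hlj]
  have h2 : ((x - y) i).natAbs + ((x - y) j).natAbs ≤
      ((x - diagRefl i j c y) i).natAbs + ((x - diagRefl i j c y) j).natAbs := by
    simp only [Pi.sub_apply, diagRefl_apply hij, if_true, if_neg hij.symm]
    omega
  rw [hrest]
  omega

/-- Signed coordinate permutations are `ℓ¹` isometries. [folklore] -/
theorem l1Norm_signedPerm_sub (π : Equiv.Perm (Fin d)) (ε : Fin d → ℤˣ) (x y : Site d) :
    l1Norm (Site.signedPerm π ε x - Site.signedPerm π ε y) = l1Norm (x - y) := by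
  unfold l1Norm
  have h1 : ∀ i, ((Site.signedPerm π ε x - Site.signedPerm π ε y) i).natAbs =
      ((x - y) (π.symm i)).natAbs := by
    intro i
    simp only [Pi.sub_apply, Site.signedPerm_apply, ← mul_sub, Int.natAbs_mul, Int.units_natAbs,
      one_mul]
  simp_rw [h1]
  exact Equiv.sum_comp π.symm (fun i => ((x - y) i).natAbs)

/-- The couplings `C₀|x-y|₁^{-d-α}` depend on `x, y` only through `|x-y|₁`. [cite: Panis2023Triviality, §1.2.1 (examples (A1)–(A5): algebraic decay)] -/
theorem algebraicCoupling_eq_of_l1Norm_eq (C₀ α : ℝ) {x y x' y' : Site d}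
    (h : l1Norm (x - y) = l1Norm (x' - y')) :
    algebraicCoupling d C₀ α x y = algebraicCoupling d C₀ α x' y' := by
  unfold algebraicCoupling
  have he : x = y ↔ x' = y' := by
    rw [← sub_eq_zero, ← l1Norm_eq_zero_iff, h, l1Norm_eq_zero_iff, sub_eq_zero]
  by_cases hxy : x = y
  · rw [if_pos hxy, if_pos (he.1 hxy)]
  · rw [if_neg hxy, if_neg (fun h' => hxy (he.2 h')), h]

/-- The couplings `C₀|x-y|₁^{-d-α}` (`C₀ ≥ 0`, `d + α ≥ 0`) are nonincreasing in `|x-y|₁` off the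
diagonal. [cite: Panis2023Triviality, §1.2.1 (examples (A1)–(A5): algebraic decay)] -/
theorem algebraicCoupling_anti {C₀ : ℝ} (hC₀ : 0 ≤ C₀) {α : ℝ} (hα : 0 ≤ (d : ℝ) + α)
    {x y y' : Site d} (hxy : x ≠ y) (h : l1Norm (x - y) ≤ l1Norm (x - y')) :
    algebraicCoupling d C₀ α x y' ≤ algebraicCoupling d C₀ α x y := by
  have h0 : 0 < l1Norm (x - y) :=
    Nat.pos_of_ne_zero fun h0 => hxy (sub_eq_zero.1 (l1Norm_eq_zero_iff.1 h0))
  have hxy' : x ≠ y' := fun h' => by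
    have h1 : l1Norm (x - y') = 0 := l1Norm_eq_zero_iff.2 (sub_eq_zero.2 h')
    omega
  unfold algebraicCoupling
  rw [if_neg hxy', if_neg hxy]
  refine mul_le_mul_of_nonneg_left ?_ hC₀
  exact Real.rpow_le_rpow_of_nonpos (by exact_mod_cast h0) (by exact_mod_cast h) (by linarith)

end L1Geometry

/-! ### The elementary Messager–Miracle-Solé steps for `ℓ¹`-nonincreasing pair couplings -/

section Steps

variable (J : Site d → Site d → ℝ) (β : ℝ)

/-- `{x} ∆ {y} = {x, y}` for `x ≠ y`. [folklore] -/
theorem singleton_symmDiff_singleton {x y : Site d} (hxy : x ≠ y) :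
    ({x} ∆ {y} : Finset (Site d)) = {x, y} := by
  ext z
  simp only [Finset.mem_symmDiff, Finset.mem_singleton, Finset.mem_insert]
  constructor
  · rintro (⟨h, -⟩ | ⟨h, -⟩)
    · exact Or.inl h
    · exact Or.inr h
  · rintro (rfl | rfl)
    · exact Or.inl ⟨rfl, hxy⟩
    · exact Or.inr ⟨rfl, Ne.symm hxy⟩

/-- `⟨σ_xσ_y⟩ = ⟨σ_{{x,y}}⟩` for `x ≠ y`. [folklore] -/
theorem pairCorrelation_eq_state_pair {x y : Site d} (hxy : x ≠ y) :
    pairCorrelation J β x y = state J β 0 (spinProduct {x, y}) := by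
  rw [pairCorrelation_eq, singleton_symmDiff_singleton hxy]

/-- **Messager–Miracle-Solé for the axis hyperplanes, pair couplings**: for `β ≥ 0`, a coupling
`J ≥ 0` depending only on `|x-y|₁` and nonincreasing in it off the diagonal, `k ∈ ℤ`, and `a ≠ b`
strictly below the plane `{yᵢ = k/2}`, `⟨σ_aσ_{θb}⟩_{J,0,β} ≤ ⟨σ_aσ_b⟩_{J,0,β}` for the reflection `θ`
through it (Panis 2023, Proposition 3.2, hyperplanes "passing through sites or mid-edges";
Hegerfeldt 1977, Thm. 3.1). [cite: Panis2023Triviality, Proposition 3.2] -/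
theorem state_pair_axisRefl_le (hJ0 : ∀ x y, 0 ≤ J x y)
    (hJl1 : ∀ x y x' y', l1Norm (x - y) = l1Norm (x' - y') → J x y = J x' y')
    (hJanti : ∀ x y y', x ≠ y → l1Norm (x - y) ≤ l1Norm (x - y') → J x y' ≤ J x y)
    (i : Fin d) (k : ℤ) (hβ : 0 ≤ β) {a b : Site d} (ha : 2 * a i < k) (hb : 2 * b i < k)
    (hab : a ≠ b) :
    state J β 0 (spinProduct {a, axisRefl i k b}) ≤ state J β 0 (spinProduct {a, b}) := by
  refine state_pair_reflect_le J β (axisRefl i k) (axisRefl_involutive i k)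
    (fun y : Site d => 2 * y i < k) ?_ ?_ hJ0
    (fun x y => hJl1 _ _ _ _ (l1Norm_axisRefl_sub i k x y)) ?_
    (R := k.natAbs) (axisRefl_mem_box i k) hβ ha hb hab
  · intro y hy
    simp only [axisRefl_apply, if_true, not_lt]
    omega
  · intro y hy hθy
    simp only [axisRefl_apply, if_true, not_lt] at hy hθy
    funext j
    rw [axisRefl_apply]
    split_ifs with h
    · subst h
      omega
    · rfl
  · intro x y hx hy hxy
    exact hJanti x y _ hxy (l1Norm_sub_le_l1Norm_sub_axisRefl i hx.le hy.le)

/-- **Messager–Miracle-Solé for the diagonal hyperplanes, pair couplings**: for `β ≥ 0`, `J ≥ 0`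
depending only on `|x-y|₁` and nonincreasing in it off the diagonal, `i ≠ j`, `c ∈ ℤ`, and `a ≠ b`
strictly below the plane `{yᵢ - yⱼ = c}`, `⟨σ_aσ_{θb}⟩_{J,0,β} ≤ ⟨σ_aσ_b⟩_{J,0,β}` for the reflection
`θ` through it (Panis 2023, Proposition 3.2, "reflections changing only two coordinates";
Hegerfeldt 1977, Thm. 3.2). [cite: Panis2023Triviality, Proposition 3.2] -/
theorem state_pair_diagRefl_le (hJ0 : ∀ x y, 0 ≤ J x y)
    (hJl1 : ∀ x y x' y', l1Norm (x - y) = l1Norm (x' - y') → J x y = J x' y')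
    (hJanti : ∀ x y y', x ≠ y → l1Norm (x - y) ≤ l1Norm (x - y') → J x y' ≤ J x y)
    {i j : Fin d} (hij : i ≠ j) (c : ℤ) (hβ : 0 ≤ β) {a b : Site d} (ha : a i - a j < c)
    (hb : b i - b j < c) (hab : a ≠ b) :
    state J β 0 (spinProduct {a, diagRefl i j c b}) ≤ state J β 0 (spinProduct {a, b}) := by
  refine state_pair_reflect_le J β (diagRefl i j c) (diagRefl_involutive hij c)
    (fun y : Site d => y i - y j < c) ?_ ?_ hJ0
    (fun x y => hJl1 _ _ _ _ (l1Norm_diagRefl_sub hij c x y)) ?_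
    (R := c.natAbs) (diagRefl_mem_box hij c) hβ ha hb hab
  · intro y hy
    simp only [diagRefl_apply hij, if_true, if_neg hij.symm, not_lt]
    omega
  · intro y hy hθy
    simp only [diagRefl_apply hij, if_true, if_neg hij.symm, not_lt] at hy hθy
    have hyc : y i - y j = c := le_antisymm (by omega) hy
    funext l
    rw [diagRefl_apply hij]
    split_ifs with h1 h2
    · subst h1; omega
    · subst h2; omega
    · rfl
  · intro x y hx hy hxy
    exact hJanti x y _ hxy (l1Norm_sub_le_l1Norm_sub_diagRefl hij hx.le hy.le)

/-- **(MMS1), axis step for `S(x) = ⟨σ₀σ_x⟩_{J,0,β}`**: `S(x + eᵢ) ≤ S(x)` for `xᵢ ≥ 0`, `β ≥ 0`, and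
`J ≥ 0` an `ℓ¹`-nonincreasing pair coupling (the reflection through `{yᵢ = xᵢ + ½}` maps `x` to
`x + eᵢ` and leaves `0`, `x` strictly below; for `x = 0` this is `S(eᵢ) ≤ 1 = S(0)`) — Panis 2023,
Corollary 3.3 (i): "the sequence `(S_β(ke_j))_{k≥0}` is decreasing"; Hegerfeldt 1977, Thm. 3.1,
eq. (3.8). [cite: Panis2023Triviality, Corollary 3.3 (i)] -/
theorem pairCorrelation_zero_add_single_le (hJ0 : ∀ x y, 0 ≤ J x y)
    (hJl1 : ∀ x y x' y', l1Norm (x - y) = l1Norm (x' - y') → J x y = J x' y')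
    (hJanti : ∀ x y y', x ≠ y → l1Norm (x - y) ≤ l1Norm (x - y') → J x y' ≤ J x y)
    (hβ : 0 ≤ β) (x : Site d) (i : Fin d) (hxi : 0 ≤ x i) :
    pairCorrelation J β 0 (x + Pi.single i 1) ≤ pairCorrelation J β 0 x := by
  by_cases hx : x = 0
  · subst hx
    rw [pairCorrelation_self]
    exact (abs_le.1 (abs_pairCorrelation_le_one J β hβ hJ0 _ _)).2
  have hθx : axisRefl i (2 * x i + 1) x = x + Pi.single i 1 := by
    funext j
    rw [axisRefl_apply, Pi.add_apply]
    by_cases hj : j = i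
    · subst hj; simp; ring
    · simp [hj]
  have hx' : x + Pi.single i 1 ≠ 0 := by
    intro h
    have := congrFun h i
    simp at this
    omega
  rw [pairCorrelation_eq_state_pair J β (Ne.symm hx'), pairCorrelation_eq_state_pair J β (Ne.symm hx),
    ← hθx]
  exact state_pair_axisRefl_le J β hJ0 hJl1 hJanti i (2 * x i + 1) hβ (a := 0) (by simp; omega)
    (by omega) (Ne.symm hx)

/-- **(MMS1), diagonal step for `S(x) = ⟨σ₀σ_x⟩_{J,0,β}`**: `S(x + eᵢ - eⱼ) ≤ S(x)` for `i ≠ j`,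
`xⱼ ≤ xᵢ`, `β ≥ 0`, and `J ≥ 0` an `ℓ¹`-nonincreasing pair coupling (the reflection through
`{yᵢ - yⱼ = xᵢ - xⱼ + 1}`; iterating it moves mass onto the largest coordinate,
`S(x) ≥ S((|x|₁, 0_⊥))`, Panis 2023, Corollary 3.3 (ii); Hegerfeldt 1977, Thm. 3.2, eq. (3.10)).
[cite: Panis2023Triviality, Corollary 3.3 (ii) (MMS1)] -/
theorem pairCorrelation_zero_add_single_sub_single_le (hJ0 : ∀ x y, 0 ≤ J x y)
    (hJl1 : ∀ x y x' y', l1Norm (x - y) = l1Norm (x' - y') → J x y = J x' y')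
    (hJanti : ∀ x y y', x ≠ y → l1Norm (x - y) ≤ l1Norm (x - y') → J x y' ≤ J x y)
    (hβ : 0 ≤ β) (x : Site d) {i j : Fin d} (hij : i ≠ j) (hxji : x j ≤ x i) :
    pairCorrelation J β 0 (x + Pi.single i 1 - Pi.single j 1) ≤ pairCorrelation J β 0 x := by
  by_cases hx : x = 0
  · subst hx
    rw [pairCorrelation_self]
    exact (abs_le.1 (abs_pairCorrelation_le_one J β hβ hJ0 _ _)).2
  set c : ℤ := x i - x j + 1 with hc
  have hθx : diagRefl i j c x = x + Pi.single i 1 - Pi.single j 1 := by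
    funext l
    rw [diagRefl_apply hij, Pi.sub_apply, Pi.add_apply]
    by_cases hli : l = i
    · subst hli; simp [hij]; omega
    · by_cases hlj : l = j
      · subst hlj; simp [hli]; omega
      · simp [hli, hlj]
  have hx' : x + Pi.single i 1 - Pi.single j 1 ≠ 0 := by
    intro h
    have h1 := congrFun h i
    have h2 := congrFun h j
    simp [hij, hij.symm] at h1 h2
    omega
  rw [pairCorrelation_eq_state_pair J β (Ne.symm hx'), pairCorrelation_eq_state_pair J β (Ne.symm hx),
    ← hθx]
  exact state_pair_diagRefl_le J β hJ0 hJl1 hJanti hij c hβ (a := 0) (by simp [hc]; omega) (by omega)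
    (Ne.symm hx)

/-- **Invariance of `S(x) = ⟨σ₀σ_x⟩_{J,h,β}` under the signed coordinate permutations of `ℤ^d`** for a
coupling depending only on `|x-y|₁` (Friedli–Velenik 2017, Exercise 3.14). [cite: FriedliVelenik2017, Exercise 3.14, p. 115] -/
theorem pairCorrelation_zero_signedPerm
    (hJl1 : ∀ x y x' y', l1Norm (x - y) = l1Norm (x' - y') → J x y = J x' y')
    (π : Equiv.Perm (Fin d)) (ε : Fin d → ℤˣ) (x : Site d) :
    pairCorrelation J β 0 (Site.signedPerm π ε x) = pairCorrelation J β 0 x := by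
  by_cases hx : x = 0
  · subst hx
    rw [Site.signedPerm_zero]
  have hx' : Site.signedPerm π ε x ≠ 0 := fun h => hx (by
    have := congrArg (Site.signedPerm π ε).symm h
    rwa [Equiv.symm_apply_apply, ← Site.signedPerm_zero π ε, Equiv.symm_apply_apply] at this)
  have hmap : ({0, x} : Finset (Site d)).map (Site.signedPerm π ε).toEmbedding =
      {0, Site.signedPerm π ε x} := by
    rw [Finset.map_insert, Finset.map_singleton]
    simp [Site.signedPerm_zero]
  rw [pairCorrelation_eq_state_pair J β (Ne.symm hx), pairCorrelation_eq_state_pair J β (Ne.symm hx'),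
    ← hmap, state_spinProduct_map_signedPerm J β π ε
      (fun a b => hJl1 _ _ _ _ (l1Norm_signedPerm_sub π ε a b)) 0]

end Steps

/-! ### The walk: from the elementary steps to `S(y) ≤ S(x)` for `d|x|_∞ ≤ |y|_∞` -/

section Walk

variable {S : Site d → ℝ}
  (haxis : ∀ (x : Site d) (i : Fin d), 0 ≤ x i → S (x + Pi.single i 1) ≤ S x)
  (hdiag : ∀ (x : Site d) (i j : Fin d), i ≠ j → x j ≤ x i →
    S (x + Pi.single i 1 - Pi.single j 1) ≤ S x)
  (hperm : ∀ (π : Equiv.Perm (Fin d)) (ε : Fin d → ℤˣ) (x : Site d), S (Site.signedPerm π ε x) = S x)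

include haxis in
/-- Iterating the axis step: `S(x + m eᵢ) ≤ S(x)` for `xᵢ ≥ 0`, `m ∈ ℕ` (Duminil-Copin 2019, §4.3,
Exercise 37 (3)–(4)). [cite: DuminilCopin2019, Exercise 37 (3)–(4), §4.3] -/
theorem walk_add_single_le (x : Site d) (i : Fin d) (hx : 0 ≤ x i) (m : ℕ) :
    S (x + Pi.single i (m : ℤ)) ≤ S x := by
  induction m with
  | zero => simp
  | succ m ih =>
      have h := haxis (x + Pi.single i (m : ℤ)) i (by simp; omega)
      have heq : x + Pi.single i (m : ℤ) + Pi.single i 1 = x + Pi.single i (((m + 1 : ℕ) : ℤ)) := by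
        rw [add_assoc, ← Pi.single_add]
        push_cast
        rfl
      rw [heq] at h
      exact h.trans ih

include haxis in
/-- Zeroing a set of coordinates of a site with nonnegative coordinates increases `S`
(Duminil-Copin 2019, §4.3, Exercise 37 (4)). [cite: DuminilCopin2019, Exercise 37 (4), §4.3] -/
theorem walk_le_zero_coords (z : Site d) (hz : ∀ i, 0 ≤ z i) (T : Finset (Fin d)) :
    S z ≤ S (fun i => if i ∈ T then 0 else z i) := by
  induction T using Finset.induction_on with
  | empty => simp
  | insert j T hjT ih =>
      refine ih.trans ?_
      have key := walk_add_single_le haxis (fun i => if i ∈ insert j T then 0 else z i) j (by simp)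
        (z j).toNat
      have heq : ((fun i => if i ∈ insert j T then (0 : ℤ) else z i) +
          Pi.single j (((z j).toNat : ℕ) : ℤ)) = fun i => if i ∈ T then 0 else z i := by
        funext i
        rw [Int.toNat_of_nonneg (hz j)]
        by_cases hij : i = j
        · subst hij
          simp [hjT]
        · simp [hij, Finset.mem_insert]
      rw [heq] at key
      exact key

include haxis in
/-- For a site `z` with nonnegative coordinates and any coordinate `i₀`, `S(z) ≤ S(z_{i₀} e_{i₀})`
(Duminil-Copin 2019, §4.3, Exercise 37 (4)). [cite: DuminilCopin2019, Exercise 37 (4), §4.3] -/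
theorem walk_le_single_of_nonneg (z : Site d) (hz : ∀ i, 0 ≤ z i) (i₀ : Fin d) :
    S z ≤ S (Pi.single i₀ (z i₀)) := by
  have h := walk_le_zero_coords haxis z hz (univ.erase i₀)
  have heq : (fun i => if i ∈ univ.erase i₀ then (0 : ℤ) else z i) = Pi.single i₀ (z i₀) := by
    funext i
    by_cases hi : i = i₀
    · subst hi
      simp
    · simp [hi]
  rwa [heq] at h

include hperm in
/-- Coordinate permutations leave `S` invariant. [cite: FriedliVelenik2017, Exercise 3.14, p. 115] -/
theorem walk_perm (π : Equiv.Perm (Fin d)) (x : Site d) : S (fun i => x (π i)) = S x := by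
  have h : (fun i => x (π i)) = Site.signedPerm π.symm 1 x := by
    funext i
    simp
  rw [h, hperm]

include hperm in
/-- Coordinate reflections leave `S` invariant. [cite: FriedliVelenik2017, Exercise 3.14, p. 115] -/
theorem walk_reflection (j : Fin d) (x : Site d) : S (Function.update x j (-x j)) = S x := by
  have h : Function.update x j (-x j) =
      Site.signedPerm (Equiv.refl _) (Function.update 1 j (-1)) x := by
    funext i
    by_cases hij : i = j
    · subst hij
      simp
    · simp [hij]
  rw [h, hperm]

include hperm in
/-- `S(|y|) = S(y)` where `|y| = (|y₁|,…,|y_d|)` (one coordinate reflection at a time).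
[cite: FriedliVelenik2017, Exercise 3.14, p. 115] -/
theorem walk_abs_eq (y : Site d) : S (fun i => |y i|) = S y := by
  suffices h : ∀ T : Finset (Fin d), S (fun i => if i ∈ T then |y i| else y i) = S y by
    simpa using h univ
  intro T
  induction T using Finset.induction_on with
  | empty => simp
  | insert j T hjT ih =>
      rw [← ih]
      by_cases hyj : 0 ≤ y j
      · congr 1
        funext i
        by_cases hij : i = j
        · subst hij
          simp [abs_of_nonneg hyj]
        · simp [Finset.mem_insert, hij]
      · rw [← walk_reflection hperm j (fun i => if i ∈ T then |y i| else y i)]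
        congr 1
        funext i
        by_cases hij : i = j
        · subst hij
          simp [hjT, abs_of_neg (not_le.1 hyj)]
        · simp [Finset.mem_insert, hij]

include hperm in
/-- `S(a e_{i₀}) = S(a e_{i₁})` (transpose the coordinates). [cite: FriedliVelenik2017, Exercise 3.14, p. 115] -/
theorem walk_single_eq_single (i₀ i₁ : Fin d) (a : ℤ) : S (Pi.single i₀ a) = S (Pi.single i₁ a) := by
  have h := walk_perm hperm (Equiv.swap i₁ i₀) (Pi.single i₀ a)
  have heq : (fun i => (Pi.single i₀ a : Site d) (Equiv.swap i₁ i₀ i)) = Pi.single i₁ a := by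
    funext i
    by_cases hi : i = i₁
    · subst hi
      simp
    · by_cases hi' : i = i₀
      · subst hi'
        rw [Equiv.swap_apply_right]
        simp [hi, Ne.symm hi]
      · rw [Equiv.swap_apply_of_ne_of_ne hi hi']
        simp [hi, hi']
  rw [heq] at h
  exact h.symm

include haxis hperm in
/-- **`S(y) ≤ S(|y|_∞ e₁)`** (reflect `y` into the positive orthant, zero all coordinates but one where
`|yᵢ| = |y|_∞`, transpose it with the first; Duminil-Copin 2019, §4.3, Exercise 37 (4), left half of
eq. (4.10); Panis 2023, Corollary 3.3, "`S((|x|,0_⊥)) ≥ S(x)`"). [cite: Panis2023Triviality, Corollary 3.3 (ii) (MMS1)] -/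
theorem walk_le_axis (hd : 1 ≤ d) (y : Site d) :
    S y ≤ S (Pi.single (⟨0, hd⟩ : Fin d) (Site.supNorm y : ℤ)) := by
  obtain ⟨i₀, hi₀⟩ := Site.exists_natAbs_eq_supNorm ⟨⟨0, hd⟩, mem_univ _⟩ y
  rw [← walk_abs_eq hperm y]
  refine (walk_le_single_of_nonneg haxis _ (fun i => abs_nonneg _) i₀).trans ?_
  have habs : |y i₀| = (Site.supNorm y : ℤ) := by rw [Int.abs_eq_natAbs, hi₀]
  change S (Pi.single i₀ |y i₀|) ≤ _
  rw [habs, walk_single_eq_single hperm i₀ ⟨0, hd⟩]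

include hdiag in
/-- Collapsing the mass of a site onto its largest coordinate with the diagonal step: if
`0 ≤ x_j ≤ x_{i₀}` for all `j ≠ i₀`, then `S((∑ᵢ xᵢ) e_{i₀}) ≤ S(x)` (Duminil-Copin 2019, §4.3,
Exercise 37 (4); Panis 2023, Corollary 3.3, "`S(x) ≥ S((|x|₁,0_⊥))`"). [cite: Panis2023Triviality, Corollary 3.3 (ii) (MMS1)] -/
theorem walk_single_sum_le (i₀ : Fin d) :
    ∀ (M : ℕ) (x : Site d), (∀ j, j ≠ i₀ → 0 ≤ x j ∧ x j ≤ x i₀) →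
      ∑ j ∈ univ.erase i₀, x j = M → S (Pi.single i₀ (∑ i, x i)) ≤ S x := by
  intro M
  induction M with
  | zero =>
      intro x hx hsum
      have hzero : ∀ j ∈ univ.erase i₀, x j = 0 :=
        (Finset.sum_eq_zero_iff_of_nonneg fun j hj =>
          (hx j (Finset.ne_of_mem_erase hj)).1).1 (by exact_mod_cast hsum)
      have hxeq : Pi.single i₀ (x i₀) = x := by
        funext j
        by_cases hj : j = i₀
        · subst hj
          simp
        · rw [Pi.single_eq_of_ne hj]
          exact (hzero j (mem_erase.2 ⟨hj, mem_univ _⟩)).symm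
      have hs : ∑ i, x i = x i₀ := by
        rw [← Finset.add_sum_erase _ _ (mem_univ i₀), Finset.sum_eq_zero hzero, add_zero]
      rw [hs, hxeq]
  | succ M ih =>
      intro x hx hsum
      obtain ⟨j, hj, hxj⟩ : ∃ j ∈ univ.erase i₀, 0 < x j := by
        by_contra hcon
        push Not at hcon
        have hle : ∑ j ∈ univ.erase i₀, x j ≤ 0 := Finset.sum_nonpos hcon
        push_cast at hsum
        omega
      have hji : j ≠ i₀ := Finset.ne_of_mem_erase hj
      set x' : Site d := x + Pi.single i₀ 1 - Pi.single j 1 with hx'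
      have hstep := hdiag x i₀ j (Ne.symm hji) (hx j hji).2
      refine le_trans ?_ hstep
      have hx'i0 : x' i₀ = x i₀ + 1 := by simp [hx', Ne.symm hji]
      have hx'j : x' j = x j - 1 := by simp [hx', hji]
      have hx'k : ∀ k, k ≠ i₀ → k ≠ j → x' k = x k := by
        intro k hk hkj
        simp [hx', hk, hkj]
      have hcond : ∀ k, k ≠ i₀ → 0 ≤ x' k ∧ x' k ≤ x' i₀ := by
        intro k hk
        by_cases hkj : k = j
        · subst hkj
          rw [hx'j, hx'i0]
          have := (hx k hk).2
          constructor <;> omega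
        · rw [hx'k k hk hkj, hx'i0]
          have := hx k hk
          constructor <;> omega
      have hsum' : ∑ k ∈ univ.erase i₀, x' k = M := by
        have h1 : ∑ k ∈ univ.erase i₀, x' k + 1 = ∑ k ∈ univ.erase i₀, x k := by
          rw [← Finset.add_sum_erase _ _ hj, ← Finset.add_sum_erase (univ.erase i₀) x hj, hx'j,
            Finset.sum_congr rfl fun k hk => hx'k k (Finset.ne_of_mem_erase (mem_of_mem_erase hk))
              (Finset.ne_of_mem_erase hk)]
          ring
        push_cast at hsum
        omega
      have htot : ∑ i, x' i = ∑ i, x i := by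
        simp only [hx', Pi.sub_apply, Pi.add_apply, Finset.sum_sub_distrib,
          Finset.sum_add_distrib, Finset.sum_pi_single', mem_univ, if_true]
        ring
      rw [← htot]
      exact ih x' hcond hsum'

include haxis hdiag hperm in
/-- **`S(d|y|_∞ e₁) ≤ S(y)`** (reflect into the positive orthant, collapse the mass
`s = ∑ᵢ|yᵢ| ≤ d|y|_∞` onto a maximal coordinate by diagonal steps, walk out along the axis from `s`
to `d|y|_∞`, transpose with the first coordinate; Duminil-Copin 2019, §4.3, Exercise 37 (4), right
half of eq. (4.10); Panis 2023, Corollary 3.3: `S(x) ≥ S((|x|₁,0_⊥)) ≥ S((d|x|_∞,0_⊥))`).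
[cite: Panis2023Triviality, Corollary 3.3 (ii) (MMS1)] -/
theorem walk_diagAxis_le (hd : 1 ≤ d) (y : Site d) :
    S (Pi.single (⟨0, hd⟩ : Fin d) ((d : ℤ) * Site.supNorm y)) ≤ S y := by
  obtain ⟨i₀, hi₀⟩ := Site.exists_natAbs_eq_supNorm ⟨⟨0, hd⟩, mem_univ _⟩ y
  set n : ℕ := Site.supNorm y with hn
  set z : Site d := fun i => |y i| with hz
  have hz0 : ∀ i, 0 ≤ z i := fun i => abs_nonneg _
  have hzle : ∀ i, z i ≤ n := fun i => by
    have h := Site.natAbs_le_supNorm y i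
    simp only [hz, Int.abs_eq_natAbs]
    exact_mod_cast h
  have hzi0 : z i₀ = n := by
    change |y i₀| = (n : ℤ)
    rw [Int.abs_eq_natAbs, hi₀]
  rw [← walk_abs_eq hperm y, walk_single_eq_single hperm ⟨0, hd⟩ i₀]
  change S (Pi.single i₀ ((d : ℤ) * n)) ≤ S z
  set s : ℤ := ∑ i, z i with hs
  have hs_le : s ≤ (d : ℤ) * n := by
    calc s = ∑ i, z i := rfl
      _ ≤ ∑ _i : Fin d, (n : ℤ) := Finset.sum_le_sum fun i _ => hzle i
      _ = d * n := by simp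
  have hs_ge : (n : ℤ) ≤ s := by
    rw [← hzi0]
    exact Finset.single_le_sum (fun i _ => hz0 i) (mem_univ i₀)
  have h1 : S (Pi.single i₀ s) ≤ S z :=
    walk_single_sum_le hdiag i₀ (∑ j ∈ univ.erase i₀, z j).toNat z
      (fun j _ => ⟨hz0 j, (hzle j).trans hzi0.ge⟩)
      (by rw [Int.toNat_of_nonneg (Finset.sum_nonneg fun j _ => hz0 j)])
  have h2 : S (Pi.single i₀ ((d : ℤ) * n)) ≤ S (Pi.single i₀ s) := by
    have h := walk_add_single_le haxis (Pi.single i₀ s) i₀ (by simp; omega) ((d : ℤ) * n - s).toNat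
    rwa [← Pi.single_add, Int.toNat_of_nonneg (by omega), add_sub_cancel] at h
  exact h2.trans h1

include haxis hdiag hperm in
/-- **The walk (MMS1 ⟹ MMS2)**: for a function `S` on `ℤ^d` (`d ≥ 1`) that decreases along the
positive axes (`S(x+eᵢ) ≤ S(x)`, `xᵢ ≥ 0`), under the diagonal moves `x ↦ x + eᵢ - eⱼ` (`xⱼ ≤ xᵢ`),
and is invariant under signed coordinate permutations, `S(y) ≤ S(x)` whenever `d|x|_∞ ≤ |y|_∞`:
`S(y) ≤ S(|y|_∞e₁) ≤ S(d|x|_∞e₁) ≤ S(x)` (Panis 2023, Corollary 3.3: "In particular, for all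
`x, y ∈ ℤ^d` with `d|x| ≤ |y|`, `S_β(x) ≥ S_β(y)`"). [cite: Panis2023Triviality, Corollary 3.3 (MMS2)] -/
theorem walk_mms2 (hd : 1 ≤ d) {x y : Site d} (hxy : d * Site.supNorm x ≤ Site.supNorm y) :
    S y ≤ S x := by
  have h1 := walk_le_axis haxis hperm hd y
  have h3 := walk_diagAxis_le haxis hdiag hperm hd x
  have h2 : S (Pi.single (⟨0, hd⟩ : Fin d) (Site.supNorm y : ℤ)) ≤
      S (Pi.single (⟨0, hd⟩ : Fin d) ((d : ℤ) * Site.supNorm x)) := by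
    have h := walk_add_single_le haxis (Pi.single (⟨0, hd⟩ : Fin d) ((d : ℤ) * Site.supNorm x))
      ⟨0, hd⟩ (by simp; positivity) (Site.supNorm y - d * Site.supNorm x)
    rwa [← Pi.single_add, Nat.cast_sub hxy, Nat.cast_mul, add_sub_cancel] at h
  exact h1.trans (h2.trans h3)

end Walk

end LongRangeIsing

open LongRangeIsing

/-! ### The discharge -/

/-- **Discharge of the named fact `panis_mms_two_point_monotone`** (Panis 2023, Corollary 3.3,
(MMS2)): for `d ≥ 1`, `C₀, α > 0`, `β > 0` and `x, y ∈ ℤ^d` with `d‖x‖_∞ ≤ ‖y‖_∞`,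
`⟨σ₀σ_y⟩_β ≤ ⟨σ₀σ_x⟩_β` for the couplings `J_{x,y} = C₀|x-y|₁^{-d-α}` and the infinite-volume state
along boxes — by the Messager–Miracle-Solé inequality for `ℓ¹`-nonincreasing ferromagnetic pair
couplings (`state_pair_axisRefl_le`, `state_pair_diagRefl_le`, from `LongRangeTrivialityOnZ3MMS.lean`)
and the walk `walk_mms2`. [cite: Panis2023Triviality, Corollary 3.3 (MMS2)] -/
theorem panis_mms_two_point_monotone_holds : panis_mms_two_point_monotone := by
  intro d hd C₀ α hC₀ hα β hβ x y hxy
  have hJ0 : ∀ a b : Site d, 0 ≤ algebraicCoupling d C₀ α a b :=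
    fun a b => algebraicCoupling_nonneg hC₀.le α a b
  have hJl1 : ∀ a b a' b' : Site d, l1Norm (a - b) = l1Norm (a' - b') →
      algebraicCoupling d C₀ α a b = algebraicCoupling d C₀ α a' b' :=
    fun a b a' b' h => algebraicCoupling_eq_of_l1Norm_eq C₀ α h
  have hJanti : ∀ a b b' : Site d, a ≠ b → l1Norm (a - b) ≤ l1Norm (a - b') →
      algebraicCoupling d C₀ α a b' ≤ algebraicCoupling d C₀ α a b :=
    fun a b b' hab h => algebraicCoupling_anti hC₀.le (by positivity) hab h
  rw [Site.norm_eq_supNorm, Site.norm_eq_supNorm] at hxy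
  have h : d * Site.supNorm x ≤ Site.supNorm y := by exact_mod_cast hxy
  exact walk_mms2 (S := fun z => pairCorrelation (algebraicCoupling d C₀ α) β 0 z)
    (fun z i hz => pairCorrelation_zero_add_single_le _ β hJ0 hJl1 hJanti hβ.le z i hz)
    (fun z i j hij hz => pairCorrelation_zero_add_single_sub_single_le _ β hJ0 hJl1 hJanti hβ.le z hij hz)
    (fun π ε z => pairCorrelation_zero_signedPerm _ β hJl1 π ε z) hd h

end Literature.Barriers.CriticalPhenomena
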